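import Summits.BirchSwinnertonDyer.Rank1Residual.Supersingular.X8PrintDischargeOnePrime
import Literature.NumberTheory.EllipticCurves.FineSelmerClassGroupCriterion
import Literature.NumberTheory.IwasawaTheory.CyclotomicRatTotallyRamified
import Literature.NumberTheory.GaloisRepresentations.AbsIntegersEquiv
import Literature.NumberTheory.GaloisRepresentations.LocalKroneckerWeberInertiaProofs
import Literature.NumberTheory.GaloisRepresentations.ArtinRestriction
import Mathlib.NumberTheory.Padics.Hensel
import HarnessLib

/-!
# Route `PrintX8`, crux `MuBoundSmallImageX8` (stmt-BirchSwinnertonDyer-20622): DISCHARGE of the structural binder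
# `hram` of the Fukuda doors — Fukuda's index is `n₀ = 0` for the cyclotomic `ℤ₃`-tower of `ℚ(W[3])` on
# X8 ∩ {¬ surj(3)} (cell `bsd-print-x8`, prover seat p2 gen 3; `--supports` 20622; closes nothing)

PARTITION (cell bsd-print-x8, leaf `ClassX8`): closes NONE; 0 census cells move.  Beyond-print theorem: NO.

HONEST FRAMING.  `Theorems/PrintX8SmallImageMuBoundCertificates.lean` (this seat, p557381) carries the two Fukuda
doors to statement (A) (`X8.conjA_of_classGroupPRank_one_eq`, `X8.conjA_of_classNumberPExp_one_eq`) and the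
disjunctive class form `muBoundSmallImageX8_of_perPairCertificates` under ONE structural binder that is not a
certificate: `hram` — «every cyclotomic `ℤ₃`-extension `κL` of `L = ℚ(W[3])` has Fukuda's index `n₀ = 0»
(`IwasawaTheory.TotallyRamifiedFrom κL 0`: each prime of `\bar ℤ_L` is unramified or TOTALLY ramified in
`L_∞/L`).  This ROUTE-INDEPENDENT file PROVES it, for every number field `K` with `g^d ∈ res(Γ_K)` for all
`g ∈ Γ_ℚ` and `p ∤ d` (§2; e.g. `K/ℚ` Galois of degree `d`) and hence on the class X8 ∩ ¬surj
(`[ℚ(W[3]) : ℚ] = 16`, ty2 g3), and restates the two Fukuda doors WITHOUT `hram` (§3); the binder-free class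
form is appended to the (route-importing) certificates file.

## The proof (Washington §13.1 over a Galois field of degree prime to `p`)

Let `K/ℚ` be finite Galois of degree `d` with `p ∤ d`, `κ` the cyclotomic `ℤ_p`-extension of `K`
(`ker κ = χ_p⁻¹(μ(ℤ_p))`, `ZpExtension.IsCyclotomic`), `𝔔` a prime of `\bar ℤ_K` above a finite place `w`.
* `w ∤ p`: `I_𝔔 ≤ ker κ` for EVERY `ℤ_p`-extension of a number field (Washington Prop. 13.2, tree theorem
  `ZpExtension.inertia_le_kerSubgroup_holds`).
* `w ∣ p`: let `𝔓 = 𝔔 ∩ \bar ℤ` (`comap` along `\bar ℤ ≅ \bar ℤ_K`), a prime above `p`; then `res⁻¹(I_𝔓) = I_𝔔`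
  for the restriction `res : Γ_K → Γ_ℚ` (`GaloisRepresentations.comap_inertia_comap_absIntegersMap`) and
  `χ_p^K = χ_p^ℚ ∘ res` (`cyclotomicCharacter_absGaloisRestrict`).  Since `K/ℚ` is Galois of degree `d`,
  `g^d ∈ res(Γ_K)` for every `g ∈ Γ_ℚ` (§1: `g^d` fixes `K ⊂ ℚ̄` pointwise because `Gal(K/ℚ)` has exponent
  dividing `d`).  Given `σ ∈ Γ_K`, put `u = χ_p^K(σ) ∈ ℤ_pˣ`; by Hensel's lemma (§1, `exists_units_pow_eq`:
  `X^{d(p−1)} − u^{p−1}` has the simple root `1 mod p` since `p ∤ d(p−1)`) there is `w₀ ∈ ℤ_pˣ` with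
  `w₀^{d(p−1)} = u^{p−1}`; total ramification of `p` in `ℚ(μ_{p^∞})` (`exists_mem_inertia_cyclotomicCharacter_eq`)
  gives `τ₀ ∈ I_𝔓` with `χ_p(τ₀) = w₀`; `τ₀^d = res τ` with `τ ∈ I_𝔔`, and `χ_p^K(τ⁻¹σ)^{p−1} =
  w₀^{−d(p−1)} u^{p−1} = 1`, so `χ_p^K(τ⁻¹σ)` is torsion, i.e. `τ⁻¹σ ∈ ker κ`: `I_𝔔 ⊔ ker κ = Γ_K`.

## Main results

* §1 `exists_units_pow_eq` (Hensel), `pow_mem_range_absGaloisRestrict_of_pow_eq_one` (Galois descent of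
  `d`-th powers into `res(Γ_K)` for an intermediate field `K ⊂ ℚ̄` normal over the base).
* §2 `totallyRamifiedFrom_zero_of_isCyclotomic_of_pow_mem_range` (any number field `K`, hypothesis
  «`g^d ∈ res(Γ_K)` for all `g`», `p ∤ d`; with §1 this covers every `K ⊂ ℚ̄` normal over `ℚ` whose
  automorphism group has exponent dividing `d`, e.g. Galois of degree `d`).
* §3 `ClassX8.totallyRamifiedFrom_zero_divisionField_of_not_surj` (the binder `hram` on X8 ∩ ¬surj) and the
  `hram`-FREE two-integer doors `X8.conjA_of_classGroupPRank_one_eq'`, `X8.conjA_of_classNumberPExp_one_eq'`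
  ((A) at the pair ⟸ `rank_3 Cl(L₁) = rank_3 Cl(L)` resp. `ord_3 h(L₁) = ord_3 h(L)`, `L = ℚ(W[3])`, granted the
  named facts Fukuda 1994 Thm. 1 and Coates–Sujatha Thm. 3.4 only).  Census (kit j287154, GRH data): the rank door
  holds on 17 of the 19 road-(γ)-uncertified small-image cells (all except 372416dm1, 442225bz1).

References: [Washington1997] §13.1, Prop. 13.2; [Fukuda1994] p. 264 (the index `n₀`); [NeukirchANT1999] Ch. I §9,
Ch. II (7.13); [CoatesSujatha2005] Thm. 3.4; tree: `IwasawaTheory/CyclotomicRatTotallyRamified.lean` (the case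
`K = ℚ`), `GaloisRepresentations/AbsIntegersEquiv.lean`, `…/LocalKroneckerWeberInertiaProofs.lean`
(`cyclotomicCharacter_absGaloisRestrict`), `…/ArtinRestriction.lean`, `EllipticCurves/IwasawaTowerTorsionOrdinaryProofs.lean`,
`Supersingular/X8PrintDischargeOnePrime.lean` (ty2 g3: `#Gal(ℚ(W[3])/ℚ) = 16`).
-/

set_option linter.dupNamespace false
set_option autoImplicit false

noncomputable section

open scoped Classical NumberField

open NumberField IsDedekindDomain WeierstrassCurve Field Polynomial
  Literature.NumberTheory.EllipticCurves
  Literature.NumberTheory.EllipticCurves.Rank1Residual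
  Literature.NumberTheory.EllipticCurves.Rank1Residual.Typed
  Literature.NumberTheory.EllipticCurves.ZpExtension Literature.NumberTheory.EllipticCurves.IwasawaAlgebra
  Literature.NumberTheory.IwasawaTheory Literature.NumberTheory.GaloisRepresentations
  Summit.BirchSwinnertonDyer.Rank1Residual.Supersingular

namespace Summit.BirchSwinnertonDyer.BirchSwinnertonDyer.Theorems.PrintX8TotallyRamified

/-! ### §1 Two lemmas: Hensel for `X^{d(p-1)} − u^{p-1}`, and `d`-th powers restrict from `Γ_K` -/

/-- **Hensel**: for `p ∤ d` every unit `u ∈ ℤ_pˣ` has `w₀^{d(p−1)} = u^{p−1}` for some unit `w₀` — the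
polynomial `X^{d(p−1)} − u^{p−1}` has `‖F(1)‖ < 1 = ‖F′(1)‖²` (`u^{p−1} ≡ 1 mod p` by Fermat, `F′(1) =
d(p−1)` a `p`-adic unit), so Mathlib's `hensels_lemma` gives a root, necessarily a unit.
[cite: Washington1997, §13.1 (the structure `ℤ_pˣ = μ × (1 + pℤ_p)` behind total ramification)] -/
theorem exists_units_pow_eq (p d : ℕ) [Fact p.Prime] (hd : ¬ p ∣ d) (u : ℤ_[p]ˣ) :
    ∃ w₀ : ℤ_[p]ˣ, w₀ ^ (d * (p - 1)) = u ^ (p - 1) := by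
  have hp : p.Prime := Fact.out
  set N : ℕ := d * (p - 1) with hN
  have hd0 : d ≠ 0 := by rintro rfl; exact hd (dvd_zero p)
  have hp1 : p - 1 ≠ 0 := by have := hp.two_le; omega
  have hN0 : N ≠ 0 := mul_ne_zero hd0 hp1
  have hpN : ¬ p ∣ N := by
    intro h
    rcases (Nat.Prime.dvd_mul hp).mp h with h1 | h1
    · exact hd h1
    · exact absurd (Nat.le_of_dvd (by omega) h1) (by omega)
  set c : ℤ_[p] := (u : ℤ_[p]) ^ (p - 1) with hc
  -- `p ∣ 1 - c` (Fermat in `ZMod p`)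
  have hdvd : (p : ℤ_[p]) ∣ 1 - c := by
    have hu0 : PadicInt.toZMod (u : ℤ_[p]) ≠ 0 :=
      ((Units.isUnit u).map PadicInt.toZMod).ne_zero
    have h1 : PadicInt.toZMod (1 - c) = 0 := by
      rw [map_sub, map_one, hc, map_pow, ZMod.pow_card_sub_one_eq_one hu0, sub_self]
    have h2 : (1 - c) ∈ RingHom.ker (PadicInt.toZMod : ℤ_[p] →+* ZMod p) := h1
    rw [PadicInt.ker_toZMod, PadicInt.maximalIdeal_eq_span_p, Ideal.mem_span_singleton] at h2
    exact h2
  -- `‖N‖ = 1`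
  have hNnorm : ‖((N : ℕ) : ℤ_[p])‖ = 1 := by
    refine le_antisymm (PadicInt.norm_le_one _) (not_lt.mp fun hlt => hpN ?_)
    rw [PadicInt.norm_lt_one_iff_dvd, ← Ideal.mem_span_singleton, ← PadicInt.maximalIdeal_eq_span_p,
      ← PadicInt.ker_toZMod, RingHom.mem_ker, map_natCast] at hlt
    exact (ZMod.natCast_eq_zero_iff N p).mp hlt
  -- the polynomial and Hensel's hypothesis
  set F : Polynomial ℤ_[p] := X ^ N - C c with hF
  have hFa : F.aeval (1 : ℤ_[p]) = 1 - c := by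
    simp [hF]
  have hF' : F.derivative.aeval (1 : ℤ_[p]) = (N : ℤ_[p]) := by
    simp [hF, Polynomial.derivative_X_pow]
  have hnorm : ‖F.aeval (1 : ℤ_[p])‖ < ‖F.derivative.aeval (1 : ℤ_[p])‖ ^ 2 := by
    rw [hFa, hF', hNnorm, one_pow]
    exact (PadicInt.norm_lt_one_iff_dvd _).mpr hdvd
  obtain ⟨z, hz, -, -, -⟩ := hensels_lemma hnorm
  have hzN : z ^ N = c := by
    have : F.aeval z = z ^ N - c := by simp [hF]
    rw [this] at hz
    exact sub_eq_zero.mp hz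
  have hzu : IsUnit z := by
    rw [← isUnit_pow_iff hN0, hzN, hc]
    exact (Units.isUnit u).pow _
  refine ⟨hzu.unit, Units.ext ?_⟩
  rw [Units.val_pow_eq_pow_val, IsUnit.unit_spec, hzN, hc, Units.val_pow_eq_pow_val]

/-- **`d`-th powers of `Γ_F` restrict from `Γ_K`** when `K ⊂ F̄` is an intermediate field, normal over `F`, whose
automorphism group has exponent dividing `d` (e.g. `#Gal(K/F) = d`): `g^d` acts on `K` through
`(g|_K)^d = 1`, so it fixes `K = e(K)` pointwise for the embedding `e` of `exists_mem_range_absGaloisRestrict_iff`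
(`AlgHom.fieldRange_of_normal`), i.e. `g^d ∈ res(Γ_K)`. [cite: NeukirchANT1999, Ch. IV §1 (restriction to a normal subextension)] -/
theorem pow_mem_range_absGaloisRestrict_of_pow_eq_one {F : Type*} [Field F]
    (K : IntermediateField F (AlgebraicClosure F)) [Normal F K] (d : ℕ)
    (hd : ∀ s : K ≃ₐ[F] K, s ^ d = 1) (g : absoluteGaloisGroup F) :
    g ^ d ∈ (absGaloisRestrict F K).range := by
  haveI : Algebra.IsAlgebraic F K := Algebra.IsAlgebraic.of_injective (IntermediateField.val K) (RingHom.injective _)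
  obtain ⟨e, he⟩ := exists_mem_range_absGaloisRestrict_iff F K
  rw [he]
  intro x
  -- `e x ∈ K` (normality), say `e x = ↑y`
  have hx : e x ∈ e.fieldRange := ⟨x, rfl⟩
  rw [AlgHom.fieldRange_of_normal] at hx
  obtain ⟨y, hy⟩ : ∃ y : K, (y : AlgebraicClosure F) = e x := ⟨⟨e x, hx⟩, rfl⟩
  rw [← hy, absoluteGaloisGroup.smul_def]
  set γ : AlgebraicClosure F ≃ₐ[F] AlgebraicClosure F := absoluteGaloisGroup.toAlgEquiv F (g ^ d) with hγ
  have h1 : γ (algebraMap K (AlgebraicClosure F) y) = algebraMap K (AlgebraicClosure F) (γ.restrictNormal K y) :=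
    (AlgEquiv.restrictNormal_commutes γ K y).symm
  have h2 : γ.restrictNormal K = 1 := by
    rw [show γ.restrictNormal K = AlgEquiv.restrictNormalHom K γ from rfl, hγ, map_pow, map_pow]
    exact hd _
  have h3 : (algebraMap K (AlgebraicClosure F) y) = (y : AlgebraicClosure F) := rfl
  rw [← h3, h1, h2, AlgEquiv.one_apply]

/-! ### §2 Fukuda's index `n₀ = 0` for the cyclotomic `ℤ_p`-extension of a Galois number field of degree prime to `p` -/

/-- A finite place of `ℚ` containing the rational prime `p` IS the place `p` (Mathlib's `primesEquiv`). [folklore] -/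
private theorem primesEquiv_eq_of_natCast_mem {p : ℕ} [Fact p.Prime] {v : HeightOneSpectrum (𝓞 ℚ)}
    (hv : ((p : ℕ) : 𝓞 ℚ) ∈ v.asIdeal) : (Rat.HeightOneSpectrum.primesEquiv v : ℕ) = p := by
  have h1 : Rat.HeightOneSpectrum.natGenerator v ∣ p := by
    rw [Rat.HeightOneSpectrum.natGenerator_dvd_iff, ← map_natCast (Rat.IsIntegralClosure.intEquiv (𝓞 ℚ)) p,
      Ideal.apply_mem_of_equiv_iff]
    exact hv
  exact (Nat.prime_dvd_prime_iff_eq (Rat.HeightOneSpectrum.prime_natGenerator v) Fact.out).mp h1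

/-- **Fukuda's index is `n₀ = 0` for the cyclotomic `ℤ_p`-extension of a number field `K` such that `g^d ∈ res(Γ_K)`
for every `g ∈ Γ_ℚ`, with `p ∤ d`** (e.g. `K/ℚ` Galois of degree `d`): every prime of `\bar ℤ_K` above a finite
place is unramified (`w ∤ p`: Washington Prop. 13.2, `ZpExtension.inertia_le_kerSubgroup_holds`) or totally ramified
(`w ∣ p`: `I_𝔔 ⊔ ker κ = Γ_K`, by the argument of the module docstring — `res⁻¹(I_𝔓) = I_𝔔`,
`χ_p^K = χ_p^ℚ ∘ res`, `χ_p(I_𝔓) = ℤ_pˣ`, Hensel) in `K_∞/K`.  A THEOREM (no named fact).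
[cite: Washington1997, §13.1 and Prop. 13.2] [cite: Fukuda1994, p. 264 (the index `n₀`)]
[cite: NeukirchANT1999, Ch. I §9 (9.4)–(9.6); Ch. II (7.13)(i)] -/
theorem totallyRamifiedFrom_zero_of_isCyclotomic_of_pow_mem_range (K : Type) [Field K] [NumberField K]
    (p d : ℕ) [Fact p.Prime] (hd : ¬ p ∣ d)
    (hpow : ∀ g : absoluteGaloisGroup ℚ, g ^ d ∈ (absGaloisRestrict ℚ K).range)
    (κ : ZpExtension K p) (hκ : κ.IsCyclotomic) : TotallyRamifiedFrom κ 0 := by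
  rw [totallyRamifiedFrom_zero_iff]
  intro w 𝔔 h𝔔
  by_cases hw : ((p : ℕ) : 𝓞 K) ∈ w.asIdeal
  · right
    -- the place of `ℚ` below `w` is `p`
    have hne : w.asIdeal.under (𝓞 ℚ) ≠ ⊥ := by
      intro h0
      have hmem : ((p : ℕ) : 𝓞 ℚ) ∈ w.asIdeal.under (𝓞 ℚ) := by
        rw [Ideal.under_def, Ideal.mem_comap, map_natCast]; exact hw
      rw [h0, Ideal.mem_bot] at hmem
      exact (Fact.out : p.Prime).ne_zero (by exact_mod_cast hmem)
    let v : HeightOneSpectrum (𝓞 ℚ) := ⟨w.asIdeal.under (𝓞 ℚ), inferInstance, hne⟩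
    have hwv : w.asIdeal.under (𝓞 ℚ) = v.asIdeal := rfl
    have hpv : ((p : ℕ) : 𝓞 ℚ) ∈ v.asIdeal := by
      change ((p : ℕ) : 𝓞 ℚ) ∈ w.asIdeal.under (𝓞 ℚ)
      rw [Ideal.under_def, Ideal.mem_comap, map_natCast]; exact hw
    have hv : (Rat.HeightOneSpectrum.primesEquiv v : ℕ) = p := primesEquiv_eq_of_natCast_mem hpv
    have h𝔓 : 𝔔.comap (absIntegersMap ℚ K) ∈ v.primesAbove := comap_absIntegersMap_mem_primesAbove hwv h𝔔
    rw [eq_top_iff]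
    intro σ _
    -- Hensel: `w₀^{d(p-1)} = χ(σ)^{p-1}`
    obtain ⟨w₀, hw₀⟩ := exists_units_pow_eq p d hd (GaloisRep.cyclotomicCharacter K p σ)
    -- total ramification of `p` in `ℚ(μ_{p^∞})`: `τ₀ ∈ I_𝔓` with `χ(τ₀) = w₀`
    obtain ⟨τ₀, hτ₀I, hτ₀χ⟩ := exists_mem_inertia_cyclotomicCharacter_eq p hv h𝔓 w₀
    -- `τ₀^d = res τ` with `τ ∈ I_𝔔`
    obtain ⟨τ, hτ⟩ := hpow τ₀
    change absGaloisRestrict ℚ K τ = τ₀ ^ d at hτ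
    have hτI : τ ∈ 𝔔.inertia (absoluteGaloisGroup K) := by
      rw [← comap_inertia_comap_absIntegersMap ℚ K 𝔔, Subgroup.mem_comap]
      change absGaloisRestrict ℚ K τ ∈ (𝔔.comap (absIntegersMap ℚ K)).inertia (absoluteGaloisGroup ℚ)
      rw [hτ]
      exact Subgroup.pow_mem _ hτ₀I d
    rw [show σ = τ * (τ⁻¹ * σ) by rw [mul_inv_cancel_left]]
    refine Subgroup.mul_mem _ (Subgroup.mem_sup_left hτI) (Subgroup.mem_sup_right ?_)
    -- `χ(τ⁻¹σ)^{p-1} = 1`, so `τ⁻¹σ ∈ ker κ = χ⁻¹(torsion)`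
    rw [show κ.kerSubgroup = _ from hκ, Subgroup.mem_comap, CommGroup.mem_torsion]
    change IsOfFinOrder (GaloisRep.cyclotomicCharacter K p (τ⁻¹ * σ))
    have hχτ : GaloisRep.cyclotomicCharacter K p τ = w₀ ^ d := by
      rw [← cyclotomicCharacter_absGaloisRestrict ℚ K p τ, hτ, map_pow, hτ₀χ]
    have hone : (GaloisRep.cyclotomicCharacter K p (τ⁻¹ * σ)) ^ (p - 1) = 1 := by
      rw [map_mul, map_inv, hχτ, mul_pow, inv_pow, ← pow_mul, hw₀, inv_mul_cancel]
    have hp1 : 0 < p - 1 := by have := (Fact.out : p.Prime).two_le; omega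
    exact isOfFinOrder_iff_pow_eq_one.mpr ⟨p - 1, hp1, hone⟩
  · left
    exact ZpExtension.inertia_le_kerSubgroup_holds K p κ hw h𝔔

/-! ### §3 At the leaf X8 ∩ {¬ surj(3)}: the binder `hram` discharged, and the `hram`-free doors and class form -/

/-- **The structural binder `hram` of `PrintX8SmallImageMuBoundCertificates` DISCHARGED on X8 ∩ {¬ surj(3)}**: for an
X8 curve `W` with `ρ̄_{W,3}` not onto, every cyclotomic `ℤ₃`-extension of `ℚ(W[3])` has Fukuda's index `n₀ = 0`
— `ℚ(W[3])/ℚ` is Galois of degree `#Gal = 16` (ty2 g3, `ClassX8.card_aut_divisionField_of_not_surj`), prime to `3`.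
[cite: Fukuda1994, p. 264 (the index `n₀`)] [cite: Washington1997, §13.1 and Prop. 13.2] [cite: Serre1972, §1.11 Prop. 12] -/
theorem ClassX8.totallyRamifiedFrom_zero_divisionField_of_not_surj (W : WeierstrassCurve ℚ) [W.IsElliptic]
    [W.IsGloballyMinimal] (p : ℕ) [Fact p.Prime] (hX : ClassX8 W p) (hns : ¬ Surj W p) :
    haveI : NeZero p := ⟨(Fact.out : p.Prime).ne_zero⟩
    ∀ κL : ZpExtension (W.divisionField p) p, κL.IsCyclotomic → TotallyRamifiedFrom κL 0 := by
  haveI : NeZero p := ⟨(Fact.out : p.Prime).ne_zero⟩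
  haveI : FiniteDimensional ℚ (W.divisionField p) := W.finiteDimensional_divisionField p
  haveI hG : IsGalois ℚ (W.divisionField p) := W.isGalois_divisionField p
  haveI : NumberField (W.divisionField p) := NumberField.mk
  intro κL hκL
  have h16 : ¬ p ∣ 16 := by rw [hX.1]; decide
  refine totallyRamifiedFrom_zero_of_isCyclotomic_of_pow_mem_range (W.divisionField p) p 16 h16
    (fun g => ?_) κL hκL
  refine pow_mem_range_absGaloisRestrict_of_pow_eq_one (W.divisionField p) 16 (fun s => ?_) g
  rw [← ClassX8.card_aut_divisionField_of_not_surj W p hX hns]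
  exact pow_card_eq_one'

/-- **(A) at an X8 pair from Fukuda's `3`-RANK certificate, binder-free**: `X8.conjA_of_classGroupPRank_one_eq` with
`hram` discharged — granted the named facts Fukuda 1994 Thm. 1 (2) (`hF2`) and Coates–Sujatha Thm. 3.4 (`hCS`), an X8
curve `W` with `ρ̄_{W,3}` not onto and `rank_3 Cl(ℚ(W[3])₁) = rank_3 Cl(ℚ(W[3]))` (`L₁` = first layer of the
cyclotomic `ℤ₃`-tower, degree 48) satisfies statement (A) at `3`.  TWO-INTEGER certificate; CONDITIONAL on the two
facts; (A) not asserted. [cite: Fukuda1994, Thm. 1 (2), p. 264] [cite: CoatesSujatha2005, Thm. 3.4 (§3)] -/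
theorem X8.conjA_of_classGroupPRank_one_eq'
    (hF2 : fukuda1994_thm1_classGroupPRank_const_of_succ_eq)
    (hCS : CoatesSujatha2005.thm34_fineSelmerDual_moduleFinite_of_classicalMuVanishes_divisionField)
    (W : WeierstrassCurve ℚ) [W.IsElliptic] [W.IsGloballyMinimal] (p : ℕ) [Fact p.Prime]
    (hX : ClassX8 W p) (hns : ¬ Surj W p)
    (hrk : haveI : NeZero p := ⟨(Fact.out : p.Prime).ne_zero⟩
      ∀ κL : ZpExtension (W.divisionField p) p, κL.IsCyclotomic →
        classGroupPRank κL 1 = classGroupPRank κL 0)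
    (κ : ZpExtension ℚ p) (hκ : κ.IsCyclotomic) :
    ∃ (γ : absoluteGaloisGroup ℚ) (D : W.FineSelmerDualData κ γ),
      Module.Finite ℤ_[p] (RestrictScalars ℤ_[p] (IwasawaAlgebra p) D.X) := by
  haveI : NeZero p := ⟨(Fact.out : p.Prime).ne_zero⟩
  haveI : NumberField (W.divisionField p) := NumberField.mk
  refine hCS W p (ClassX8.p_ne_two W p hX) ?_ κ hκ
  intro κL hL
  exact classicalMuVanishes_of_classGroupPRank_succ_eq hF2 κL
    (ClassX8.totallyRamifiedFrom_zero_divisionField_of_not_surj W p hX hns κL hL) le_rfl (hrk κL hL)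

/-- **(A) at an X8 pair from Fukuda's class-number-ORDER certificate, binder-free**: `X8.conjA_of_classNumberPExp_one_eq`
with `hram` discharged (`ord_3 h(ℚ(W[3])₁) = ord_3 h(ℚ(W[3]))`, Fukuda 1994 Thm. 1 (1) `hF1`, Coates–Sujatha `hCS`).
CONDITIONAL; (A) not asserted. [cite: Fukuda1994, Thm. 1 (1), p. 264] [cite: CoatesSujatha2005, Thm. 3.4 (§3)] -/
theorem X8.conjA_of_classNumberPExp_one_eq'
    (hF1 : fukuda1994_thm1_classNumberPExp_const_of_succ_eq)
    (hCS : CoatesSujatha2005.thm34_fineSelmerDual_moduleFinite_of_classicalMuVanishes_divisionField)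
    (W : WeierstrassCurve ℚ) [W.IsElliptic] [W.IsGloballyMinimal] (p : ℕ) [Fact p.Prime]
    (hX : ClassX8 W p) (hns : ¬ Surj W p)
    (hord : haveI : NeZero p := ⟨(Fact.out : p.Prime).ne_zero⟩
      ∀ κL : ZpExtension (W.divisionField p) p, κL.IsCyclotomic →
        classNumberPExp κL 1 = classNumberPExp κL 0)
    (κ : ZpExtension ℚ p) (hκ : κ.IsCyclotomic) :
    ∃ (γ : absoluteGaloisGroup ℚ) (D : W.FineSelmerDualData κ γ),
      Module.Finite ℤ_[p] (RestrictScalars ℤ_[p] (IwasawaAlgebra p) D.X) := by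
  haveI : NeZero p := ⟨(Fact.out : p.Prime).ne_zero⟩
  haveI : NumberField (W.divisionField p) := NumberField.mk
  refine hCS W p (ClassX8.p_ne_two W p hX) ?_ κ hκ
  intro κL hL
  exact classicalMuVanishes_of_classNumberPExp_succ_eq hF1 κL
    (ClassX8.totallyRamifiedFrom_zero_divisionField_of_not_surj W p hX hns κL hL) le_rfl (hord κL hL)

end Summit.BirchSwinnertonDyer.BirchSwinnertonDyer.Theorems.PrintX8TotallyRamified


/-! ## APPEND (p2 g3, 2026-08-27T19:5xZ): the Fukuda doors at ANY layer `n` (Thm 1 with `n ≥ n₀ = 0`)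

The first-layer data (kit j287154) leave exactly one of the 61 small-image census cells without a printed per-pair
certificate — 372416dm1, where `rank_3 Cl(L₁) = 4 > 2 = rank_3 Cl(L)` (Fukuda inconclusive at `n = 0`).  Fukuda's
theorem allows ANY `n ≥ n₀`; with `n₀ = 0` proved above, a rank (or order) equality between two consecutive HIGHER layers
(`L₂ = L·ℚ(ζ₂₇)⁺`, degree 144, …; layer-2 data = kit j288116) is an equally valid certificate.  These doors take
`∃ n, rank_3 Cl(L_{n+1}) = rank_3 Cl(L_n)` (resp. `ord_3 h`). -/

namespace Summit.BirchSwinnertonDyer.BirchSwinnertonDyer.Theorems.PrintX8TotallyRamified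

/-- **(A) at an X8 pair from Fukuda's RANK certificate at any layer, binder-free**: granted Fukuda 1994 Thm. 1 (2) (`hF2`)
and Coates–Sujatha Thm. 3.4 (`hCS`), an X8 curve `W` with `ρ̄_{W,3}` not onto such that every cyclotomic `ℤ₃`-extension of
`ℚ(W[3])` has two consecutive layers with the same `3`-rank of the class group (`∃ n, rank_3 Cl(L_{n+1}) = rank_3 Cl(L_n)`;
Fukuda's `n ≥ n₀` is automatic since `n₀ = 0`, `ClassX8.totallyRamifiedFrom_zero_divisionField_of_not_surj`) satisfies
statement (A) at `3`.  CONDITIONAL on the two named facts; (A) not asserted. [cite: Fukuda1994, Thm. 1 (2), p. 264]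
[cite: CoatesSujatha2005, Thm. 3.4 (§3)] -/
theorem X8.conjA_of_classGroupPRank_succ_eq
    (hF2 : fukuda1994_thm1_classGroupPRank_const_of_succ_eq)
    (hCS : CoatesSujatha2005.thm34_fineSelmerDual_moduleFinite_of_classicalMuVanishes_divisionField)
    (W : WeierstrassCurve ℚ) [W.IsElliptic] [W.IsGloballyMinimal] (p : ℕ) [Fact p.Prime]
    (hX : ClassX8 W p) (hns : ¬ Surj W p)
    (hrk : haveI : NeZero p := ⟨(Fact.out : p.Prime).ne_zero⟩
      ∀ κL : ZpExtension (W.divisionField p) p, κL.IsCyclotomic →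
        ∃ n : ℕ, classGroupPRank κL (n + 1) = classGroupPRank κL n)
    (κ : ZpExtension ℚ p) (hκ : κ.IsCyclotomic) :
    ∃ (γ : absoluteGaloisGroup ℚ) (D : W.FineSelmerDualData κ γ),
      Module.Finite ℤ_[p] (RestrictScalars ℤ_[p] (IwasawaAlgebra p) D.X) := by
  haveI : NeZero p := ⟨(Fact.out : p.Prime).ne_zero⟩
  haveI : NumberField (W.divisionField p) := NumberField.mk
  refine hCS W p (ClassX8.p_ne_two W p hX) ?_ κ hκ
  intro κL hL
  obtain ⟨n, hn⟩ := hrk κL hL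
  exact classicalMuVanishes_of_classGroupPRank_succ_eq hF2 κL
    (ClassX8.totallyRamifiedFrom_zero_divisionField_of_not_surj W p hX hns κL hL) (Nat.zero_le n) hn

/-- **(A) at an X8 pair from Fukuda's class-number-ORDER certificate at any layer, binder-free**: as
`X8.conjA_of_classGroupPRank_succ_eq` with `∃ n, ord_3 h(L_{n+1}) = ord_3 h(L_n)` and Fukuda 1994 Thm. 1 (1) (`hF1`).
CONDITIONAL; (A) not asserted. [cite: Fukuda1994, Thm. 1 (1), p. 264] [cite: CoatesSujatha2005, Thm. 3.4 (§3)] -/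
theorem X8.conjA_of_classNumberPExp_succ_eq
    (hF1 : fukuda1994_thm1_classNumberPExp_const_of_succ_eq)
    (hCS : CoatesSujatha2005.thm34_fineSelmerDual_moduleFinite_of_classicalMuVanishes_divisionField)
    (W : WeierstrassCurve ℚ) [W.IsElliptic] [W.IsGloballyMinimal] (p : ℕ) [Fact p.Prime]
    (hX : ClassX8 W p) (hns : ¬ Surj W p)
    (hord : haveI : NeZero p := ⟨(Fact.out : p.Prime).ne_zero⟩
      ∀ κL : ZpExtension (W.divisionField p) p, κL.IsCyclotomic →
        ∃ n : ℕ, classNumberPExp κL (n + 1) = classNumberPExp κL n)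
    (κ : ZpExtension ℚ p) (hκ : κ.IsCyclotomic) :
    ∃ (γ : absoluteGaloisGroup ℚ) (D : W.FineSelmerDualData κ γ),
      Module.Finite ℤ_[p] (RestrictScalars ℤ_[p] (IwasawaAlgebra p) D.X) := by
  haveI : NeZero p := ⟨(Fact.out : p.Prime).ne_zero⟩
  haveI : NumberField (W.divisionField p) := NumberField.mk
  refine hCS W p (ClassX8.p_ne_two W p hX) ?_ κ hκ
  intro κL hL
  obtain ⟨n, hn⟩ := hord κL hL
  exact classicalMuVanishes_of_classNumberPExp_succ_eq hF1 κL
    (ClassX8.totallyRamifiedFrom_zero_divisionField_of_not_surj W p hX hns κL hL) (Nat.zero_le n) hn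

end Summit.BirchSwinnertonDyer.BirchSwinnertonDyer.Theorems.PrintX8TotallyRamified

end
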